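import Mathlib

/-!
# T5CharacterExtension — characters of a subgroup of a finite abelian group extend to the group

Cell pub-hodge-repro2, Tier 5, sub-step N5 (route/T5-route-2.md §N5.11: the standard fact (A3b),
used in Lemma N5.L4(iv-a)/(iv-b) and three times in Theorem N5.T3's descent at the auxiliary places;
re-derived in route/T5-CHECK-N5-p4.md §2.4/§2.8); kernel support by seat p4.

(A3b) as used: «characters of a subgroup of a finite abelian group extend to the group (restriction
is surjective)».  This file kernel-checks exactly that, for Mathlib's `AddChar G ℂ` (the complex
characters of a finite abelian group `G`, written additively; the multiplicative groups of the prose —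
`E¹_w/(E¹_w ∩ U²)`, `G″` — are finite abelian groups and are covered through `Additive`):

* `res H : AddChar G ℂ →* AddChar H ℂ` — restriction to a subgroup `H`;
* `exists_infl_of_mem_ker` — a character trivial on `H` is inflated from `G ⧸ H`;
* `res_surjective` / `exists_extension` — **every character of `H` is the restriction of a character
  of `G`** (proof by counting: `|ker res| ≤ |G ⧸ H|`, `|AddChar G ℂ| = |G|`, `|AddChar H ℂ| = |H|`, so
  `|range res| = |G| / |ker res| ≥ |H|`).

Not modelled: the topological half of (A3b) (continuous characters of an open subgroup of finite
index of a locally compact abelian group) — it reduces to this statement applied to the finite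
quotient by an open subgroup on which the character is trivial.
-/

namespace Summit.Ventures.HodgeRepro2.T5CharacterExtension

open AddChar Function

variable {G : Type*} [AddCommGroup G] [Fintype G]

/-- Restriction of complex characters of `G` to the subgroup `H`, as a monoid homomorphism. -/
def res (H : AddSubgroup G) : AddChar G ℂ →* AddChar H ℂ where
  toFun ψ := ψ.compAddMonoidHom H.subtype
  map_one' := by ext; simp
  map_mul' ψ φ := by ext; simp

omit [Fintype G] in
/-- `res H ψ h = ψ h`. -/
theorem res_apply (H : AddSubgroup G) (ψ : AddChar G ℂ) (h : H) : res H ψ h = ψ h := rfl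

/-- Inflation of a character of `G ⧸ H` to `G`. -/
def infl (H : AddSubgroup G) (ψ : AddChar (G ⧸ H) ℂ) : AddChar G ℂ :=
  ψ.compAddMonoidHom (QuotientAddGroup.mk' H)

omit [Fintype G] in
/-- Inflation is injective (the projection `G → G ⧸ H` is onto). -/
theorem infl_injective (H : AddSubgroup G) : Injective (infl H) :=
  compAddMonoidHom_injective_left _ (QuotientAddGroup.mk'_surjective H)

omit [Fintype G] in
/-- The kernel of restriction: the characters trivial on `H`. -/
theorem mem_ker_res_iff (H : AddSubgroup G) (ψ : AddChar G ℂ) :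
    ψ ∈ (res H).ker ↔ ∀ x ∈ H, ψ x = 1 := by
  rw [MonoidHom.mem_ker]
  constructor
  · intro h x hx
    have := DFunLike.congr_fun h ⟨x, hx⟩
    simpa [res_apply] using this
  · intro h
    ext x
    simp [res_apply, h x.1 x.2]

omit [Fintype G] in
/-- A character trivial on `H` is inflated from a character of `G ⧸ H`. -/
theorem exists_infl_of_mem_ker (H : AddSubgroup G) {ψ : AddChar G ℂ} (hψ : ψ ∈ (res H).ker) :
    ∃ ψ' : AddChar (G ⧸ H) ℂ, infl H ψ' = ψ := by
  rw [mem_ker_res_iff] at hψ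
  have hle : H ≤ (toAddMonoidHomEquiv ψ).ker := by
    intro x hx
    rw [AddMonoidHom.mem_ker, toAddMonoidHomEquiv_apply, hψ x hx]
    rfl
  refine ⟨toAddMonoidHomEquiv.symm (QuotientAddGroup.lift H (toAddMonoidHomEquiv ψ) hle), ?_⟩
  ext x
  simp only [infl, compAddMonoidHom_apply, QuotientAddGroup.mk'_apply, toAddMonoidHomEquiv_symm_apply,
    QuotientAddGroup.lift_mk, toAddMonoidHomEquiv_apply]
  rfl

/-- `|ker (res H)| ≤ |G ⧸ H|`. -/
theorem card_ker_res_le (H : AddSubgroup G) : Nat.card (res H).ker ≤ Nat.card (G ⧸ H) := by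
  classical
  have hsub : ((res H).ker : Set (AddChar G ℂ)) ⊆ Set.range (infl H) :=
    fun ψ hψ => exists_infl_of_mem_ker H hψ
  calc Nat.card (res H).ker
      ≤ Nat.card (Set.range (infl H)) := Nat.card_mono (Set.toFinite _) hsub
    _ = Nat.card (AddChar (G ⧸ H) ℂ) := Nat.card_range_of_injective (infl_injective H)
    _ = Nat.card (G ⧸ H) := by
        rw [Nat.card_eq_fintype_card, AddChar.card_eq, ← Nat.card_eq_fintype_card]

/-- **(A3b), counting form**: restriction to a subgroup is surjective on complex characters of a
finite abelian group. -/
theorem res_surjective (H : AddSubgroup G) : Surjective (res H) := by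
  classical
  rw [← MonoidHom.range_eq_top]
  apply Subgroup.eq_top_of_le_card
  -- |range| · |ker| = |AddChar G ℂ| = |G| = |G ⧸ H| · |H|
  have h1 : Nat.card (AddChar G ℂ) = Nat.card (AddChar G ℂ ⧸ (res H).ker) * Nat.card (res H).ker :=
    Subgroup.card_eq_card_quotient_mul_card_subgroup _
  have hrange : Nat.card (res H).range = Nat.card (AddChar G ℂ ⧸ (res H).ker) :=
    (Nat.card_congr (QuotientGroup.quotientKerEquivRange (res H)).toEquiv).symm
  have h2 : Nat.card G = Nat.card (G ⧸ H) * Nat.card H :=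
    AddSubgroup.card_eq_card_quotient_mul_card_addSubgroup H
  have hG : Nat.card (AddChar G ℂ) = Nat.card G := by
    rw [Nat.card_eq_fintype_card, AddChar.card_eq, ← Nat.card_eq_fintype_card]
  have hH : Nat.card (AddChar H ℂ) = Nat.card H := by
    rw [Nat.card_eq_fintype_card, AddChar.card_eq, ← Nat.card_eq_fintype_card]
  have hker := card_ker_res_le H
  have hkpos : 0 < Nat.card (res H).ker := Nat.card_pos
  -- `|H| · |ker| ≤ |G ⧸ H| · |H| = |G| = |range| · |ker|`
  have key : Nat.card H * Nat.card (res H).ker ≤ Nat.card (res H).range * Nat.card (res H).ker := by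
    calc Nat.card H * Nat.card (res H).ker
        ≤ Nat.card H * Nat.card (G ⧸ H) := Nat.mul_le_mul_left _ hker
      _ = Nat.card G := by rw [h2, mul_comm]
      _ = Nat.card (res H).range * Nat.card (res H).ker := by rw [← hG, h1, hrange]
  rw [hH]
  exact Nat.le_of_mul_le_mul_right key hkpos

/-- **(A3b)**: every complex character of a subgroup `H` of a finite abelian group `G` extends to a
character of `G`. -/
theorem exists_extension (H : AddSubgroup G) (χ : AddChar H ℂ) :
    ∃ ψ : AddChar G ℂ, ∀ h : H, ψ h = χ h := by
  obtain ⟨ψ, hψ⟩ := res_surjective H χ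
  exact ⟨ψ, fun h => by rw [← hψ, res_apply]⟩

/-- Separation form used in Lemma N5.L4(iv-b) / (A10): for `x ∉ H` there is a character of `G`
trivial on `H` and non-trivial at `x` (a character of `G ⧸ H` non-trivial at the class of `x`,
inflated). -/
theorem exists_trivial_on_ne_one (H : AddSubgroup G) {x : G} (hx : x ∉ H) :
    ∃ ψ : AddChar G ℂ, (∀ y ∈ H, ψ y = 1) ∧ ψ x ≠ 1 := by
  have hx' : (x : G ⧸ H) ≠ 0 := by
    rwa [ne_eq, QuotientAddGroup.eq_zero_iff]
  obtain ⟨ψ', hψ'⟩ := (AddChar.exists_apply_ne_zero (α := G ⧸ H)).mpr hx'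
  refine ⟨infl H ψ', fun y hy => ?_, ?_⟩
  · simp only [infl, compAddMonoidHom_apply, QuotientAddGroup.mk'_apply]
    rw [(QuotientAddGroup.eq_zero_iff y).mpr hy, map_zero_eq_one]
  · simpa [infl] using hψ'

end Summit.Ventures.HodgeRepro2.T5CharacterExtension
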